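import Summits.FinalStateConjecture.FinalStateConjecture.Theorems.ClusterCompletenessOmegaLimitMultiKerrInvariancePrinciple
import HarnessLib

/-!
# Route ClusterCompleteness · crux `OmegaLimitMultiKerr` — the invariance principle in TRANSFER
# form: a local flux dominated on late windows by the decrements of a far-away convergent monotone
# quantity vanishes identically on ω-limits; a definite flux of `∂ₑ` makes ω-limits STATIONARY

Structure lemmas for the crux stmt-FinalStateConjecture-14664 (`ClusterCompleteness.OmegaLimitMultiKerr`,
rank 9), line `Sketch`, lead gen 5, registered stub `flux_omegaLimit_translate_eq_zero_of_transfer`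
(closed form). Companion of `…InvariancePrinciple`.

Why a transfer form. In general relativity the monotone quantities (Bondi mass `M_B(u)`, horizon
area) live at the ENDS of the exterior and are functions of TIME only; they are not functionals of
the near-zone chart fields whose translates have ω-limits, let alone continuous ones. What ties
them to the charts is an ENERGY IDENTITY: the flux `Φ_K` of a suitable current through a compact
chart region `K` over a late window `[t, t + L]` is bounded by the mass radiated through the ends
over a slightly longer retarded window, plus an error that dies out,
`∫_t^{t+L} Φ_K ≤ C · (M(t − c) − M(t + L + c)) + err(t)`. This file turns exactly that shape of
input into the LaSalle conclusion, with no integrability or differentiability asked of `M`: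

* `tendsto_zero_of_uniformContinuousOn_of_tendsto_setIntegral_Icc` — **window Barbalat**: a
  nonnegative function, uniformly continuous on a half-line, whose integrals over the late windows
  `[t, t + L]` (ONE width `L > 0`) tend to `0`, tends to `0` (Barbalat's proof uses nothing else).
* `tendsto_setIntegral_Icc_of_transfer` — the transfer inequality with `M → M_f`, `err → 0` forces
  the window integrals of the flux to `0` (squeeze).
* `flux_omegaLimit_translate_eq_zero_of_transfer` (registered stub) — **composite**: transfer
  inequality + `M` convergent + `err → 0` + flux nonnegative and uniformly continuous in time
  (tameness, cf. `supCkENorm_translate_sub_translate_le`) + flux sequentially continuous along the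
  orbit ⇒ the flux VANISHES ON EVERY TRANSLATE OF EVERY ω-LIMIT (`lyapunov_omegaLimit_translate_eq`
  with `L = 0`).
* `translate_eq_self_of_fderiv_apply_eq_zero` — a field whose derivative in the direction `e`
  vanishes on an `e`-invariant set on which it is differentiable is invariant under all
  `e`-translations there (mean value theorem along the lines `x + ℝe`).
* `omegaLimit_translate_eq_self_of_definite_flux` — **stationarity of ω-limits**: if the fluxes of
  an exhausting family are DEFINITE for `∂ₑ` (`Φ_K f = 0 ⇒ ∂ₑ f = 0` on `K`) and vanish on all
  translates of an ω-limit `g` differentiable on `O`, then `g (x + s • e) = g x` on `O`: the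
  ω-limit is invariant under the background's Killing translation — the typed form of "dark limits
  are stationary in era gauge", whose INPUT is now isolated as the transfer inequality for a
  `∂ₑ`-definite local flux (the physics; not claimed here).

Everything is proved; Mathlib + the landed files only; no definitions. LaSalle 1960; Hale 1980,
Ch. X §1; Barbalat 1959; for the GR reading: Bondi–van der Burg–Metzner 1962 §5 (mass loss =
news flux), Christodoulou–Klainerman 1993 Ch. 17 (`M(u) → M(+∞)`, `∫∫|Ξ|² < ∞`).
-/

-- every `Summit.FinalStateConjecture.FinalStateConjecture.…` name repeats the summit = sub-problem segment (D-0017 layout)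
set_option linter.dupNamespace false

noncomputable section

open Set Filter Topology Function
open scoped ContDiff Topology ENNReal

namespace Summit.FinalStateConjecture.FinalStateConjecture.Theorems.ClusterCompleteness

open Literature.Geometry.Lorentzian MeasureTheory

/-! ### Window Barbalat -/

/-- **Window Barbalat.** A real function `f`, nonnegative and uniformly continuous on a half-line
`[a, ∞)`, whose integrals over the late windows `[t, t + L]` of one fixed width `L > 0` tend to
`0` as `t → +∞`, tends to `0` at `+∞`: if `f t ≥ ε` at a late `t`, uniform continuity gives
`f ≥ ε / 2` on `[t, t + δ]` (`δ ≤ L`), whence `∫_{[t, t + L]} f ≥ ∫_{[t, t + δ]} f ≥ ε δ / 2`.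
Barbalat 1959 (the proof of the classical lemma uses only the window tails); Khalil, *Nonlinear
Systems*, Lemma 8.2. [folklore] -/
theorem tendsto_zero_of_uniformContinuousOn_of_tendsto_setIntegral_Icc {f : ℝ → ℝ} {a L : ℝ}
    (hL : 0 < L) (hu : UniformContinuousOn f (Ici a)) (hf0 : ∀ t ∈ Ici a, 0 ≤ f t)
    (hw : Tendsto (fun t ↦ ∫ s in Icc t (t + L), f s) atTop (𝓝 0)) :
    Tendsto f atTop (𝓝 0) := by
  rw [Metric.tendsto_nhds]
  intro ε hε
  obtain ⟨δ, hδ, hδf⟩ := Metric.uniformContinuousOn_iff_le.1 hu (ε / 2) (half_pos hε)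
  set δ' := min δ L with hδ'
  have hδ'pos : 0 < δ' := lt_min hδ hL
  filter_upwards [hw.eventually (gt_mem_nhds (by positivity : (0 : ℝ) < ε / 2 * δ')),
    eventually_ge_atTop a] with t ht hta
  rw [dist_zero_right, Real.norm_eq_abs, abs_of_nonneg (hf0 t hta)]
  by_contra! hcon
  -- on the window `[t, t + δ']` the function stays above `ε / 2`
  have hwin : ∀ s ∈ Icc t (t + δ'), ε / 2 ≤ f s := by
    intro s hs
    have hts : dist t s ≤ δ := by
      rw [dist_comm, Real.dist_eq, abs_of_nonneg (by linarith [hs.1])]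
      linarith [hs.2, min_le_left δ L]
    have h1 : dist (f t) (f s) ≤ ε / 2 := hδf t hta s (hta.trans hs.1) hts
    rw [Real.dist_eq] at h1
    linarith [le_abs_self (f t - f s)]
  -- continuity on the half-line gives local integrability
  have hcont : ContinuousOn f (Ici a) := hu.continuousOn
  have hintL : IntegrableOn f (Icc t (t + L)) :=
    (hcont.mono fun s hs ↦ hta.trans hs.1).integrableOn_compact isCompact_Icc
  -- the short window integral is at least `ε δ' / 2` …
  have hle : ε / 2 * δ' ≤ ∫ s in Icc t (t + δ'), f s := by
    have hfn : IntegrableOn f (Icc t (t + δ')) :=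
      hintL.mono_set (Icc_subset_Icc le_rfl (by linarith [min_le_right δ L]))
    have h := setIntegral_ge_of_const_le_real (μ := volume) measurableSet_Icc
      measure_Icc_lt_top.ne hwin hfn
    rwa [Real.volume_real_Icc_of_le (by linarith), add_sub_cancel_left] at h
  -- … and at most the long window integral, since `f ≥ 0` there
  have hmono : ∫ s in Icc t (t + δ'), f s ≤ ∫ s in Icc t (t + L), f s :=
    setIntegral_mono_set hintL
      (ae_restrict_of_forall_mem measurableSet_Icc fun s hs ↦ hf0 s (hta.trans hs.1))
      (ae_of_all _ (Icc_subset_Icc le_rfl (by linarith [min_le_right δ L])))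
  linarith

/-! ### The transfer inequality forces vanishing window fluxes -/

/-- **Transfer.** If the late window integrals of a flux `F` are nonnegative and bounded by the
decrements of a CONVERGENT quantity `M` over slightly longer windows plus an error tending to `0`,
`∫_{[t, t + L]} F ≤ C · (M (t − c) − M (t + L + c)) + err t`, then they tend to `0` (squeeze: the
right-hand side tends to `C · (M_f − M_f) + 0`). The shape of the energy identities of general
relativity (flux through a compact region ≤ mass radiated through the ends; Bondi–van der
Burg–Metzner 1962, §5; Christodoulou–Klainerman 1993, Ch. 17, 17.0.9). [folklore] -/
theorem tendsto_setIntegral_Icc_of_transfer {F M err : ℝ → ℝ} {a L c C Mf : ℝ}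
    (hF : ∀ t ∈ Ici a, 0 ≤ ∫ s in Icc t (t + L), F s)
    (hle : ∀ t ∈ Ici a, ∫ s in Icc t (t + L), F s ≤ C * (M (t - c) - M (t + L + c)) + err t)
    (hM : Tendsto M atTop (𝓝 Mf)) (herr : Tendsto err atTop (𝓝 0)) :
    Tendsto (fun t ↦ ∫ s in Icc t (t + L), F s) atTop (𝓝 0) := by
  have h1 : Tendsto (fun t : ℝ ↦ M (t - c)) atTop (𝓝 Mf) :=
    hM.comp (tendsto_atTop_add_const_right _ _ tendsto_id)
  have h2 : Tendsto (fun t : ℝ ↦ M (t + L + c)) atTop (𝓝 Mf) :=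
    hM.comp (tendsto_atTop_add_const_right _ _ (tendsto_atTop_add_const_right _ _ tendsto_id))
  have h3 : Tendsto (fun t : ℝ ↦ C * (M (t - c) - M (t + L + c)) + err t) atTop (𝓝 0) := by
    have := ((h1.sub h2).const_mul C).add herr
    simpa only [sub_self, mul_zero, zero_add] using this
  refine tendsto_of_tendsto_of_tendsto_of_le_of_le' tendsto_const_nhds h3 ?_ ?_
  · filter_upwards [eventually_ge_atTop a] with t ht using hF t ht
  · filter_upwards [eventually_ge_atTop a] with t ht using hle t ht

/-- **Invariance principle, transfer form** (registered structure stub of line `Sketch`, crux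
stmt-FinalStateConjecture-14664; closed form). Setting of `lyapunov_omegaLimit_translate_eq`: `O`
invariant under the translations by `e`, `h` the orbit's field, `Φ` a real functional. Suppose:
the flux along the orbit `t ↦ Φ (h (· + t • e))` is nonnegative and uniformly continuous on
`[a, ∞)` (tameness in time); the TRANSFER INEQUALITY
`∫_{[t, t + L]} Φ (h (· + s • e)) ds ≤ C · (M (t − c) − M (t + L + c)) + err t` holds for `t ≥ a`
with some `L > 0`, a convergent `M : ℝ → ℝ` (a far-away monotone quantity: Bondi mass, horizon
area — a function of time only) and `err → 0`; and `Φ` is sequentially continuous along the orbit.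
Then `Φ (g (· + s • e)) = 0` for every ω-limit `g` of `h` and every `s ∈ ℝ`
(`tendsto_setIntegral_Icc_of_transfer`, window Barbalat, `lyapunov_omegaLimit_translate_eq` with
`L = 0`). LaSalle 1960 / Hale 1980, Ch. X, §1, in the form the energy identities of general
relativity can feed. [cite: Hale1980, Ch. X §1] -/
theorem flux_omegaLimit_translate_eq_zero_of_transfer :
    ∀ {E : Type*} [NormedAddCommGroup E] [NormedSpace ℝ E]
      {W : Type*} [NormedAddCommGroup W] [NormedSpace ℝ W]
      {O : Set E} {e : E}, (∀ x ∈ O, ∀ s : ℝ, x + s • e ∈ O) →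
      ∀ {k : ℕ} {h : E → W} (Φ : (E → W) → ℝ) (M err : ℝ → ℝ) {a L c C Mf : ℝ}, 0 < L →
      (∀ t ∈ Ici a, 0 ≤ Φ (fun x ↦ h (x + t • e))) →
      UniformContinuousOn (fun t : ℝ ↦ Φ (fun x ↦ h (x + t • e))) (Ici a) →
      (∀ t ∈ Ici a, ∫ s in Icc t (t + L), Φ (fun x ↦ h (x + s • e)) ≤
        C * (M (t - c) - M (t + L + c)) + err t) →
      Tendsto M atTop (𝓝 Mf) → Tendsto err atTop (𝓝 0) →
      (∀ (t : ℕ → ℝ) (g' : E → W), Tendsto t atTop atTop →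
        (∀ K ⊆ O, IsCompact K →
          Tendsto (fun n ↦ supCkENorm K k (fun x ↦ h (x + t n • e) - g' x)) atTop (𝓝 0)) →
        Tendsto (fun n ↦ Φ (fun x ↦ h (x + t n • e))) atTop (𝓝 (Φ g'))) →
      ∀ {g : E → W} {T : ℕ → ℝ}, Tendsto T atTop atTop →
      (∀ K ⊆ O, IsCompact K →
        Tendsto (fun n ↦ supCkENorm K k (fun x ↦ h (x + T n • e) - g x)) atTop (𝓝 0)) →
      ∀ s : ℝ, Φ (fun x ↦ g (x + s • e)) = 0 := by
  intro E _ _ W _ _ O e hO k h Φ M err a L c C Mf hL h0 hu htr hM herr hΦ g T hT hlim s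
  -- window integrals of the flux along the orbit tend to `0`
  have hw : Tendsto (fun t ↦ ∫ τ in Icc t (t + L), Φ (fun x ↦ h (x + τ • e))) atTop (𝓝 0) := by
    refine tendsto_setIntegral_Icc_of_transfer (fun t ht ↦ ?_) htr hM herr
    exact setIntegral_nonneg measurableSet_Icc fun τ hτ ↦ h0 τ (le_trans ht hτ.1)
  -- window Barbalat: the flux along the orbit tends to `0`
  have hz : Tendsto (fun t : ℝ ↦ Φ (fun x ↦ h (x + t • e))) atTop (𝓝 0) :=
    tendsto_zero_of_uniformContinuousOn_of_tendsto_setIntegral_Icc hL hu h0 hw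
  exact lyapunov_omegaLimit_translate_eq hO Φ hz hΦ hT hlim s

/-! ### A definite flux of `∂ₑ` makes ω-limits stationary -/

/-- **Vanishing `e`-derivative on an `e`-invariant set means `e`-translation invariance there.**
If `g` is differentiable at every point of a set `O` invariant under all translations
`x ↦ x + s • e` and `fderiv ℝ g y e = 0` for all `y ∈ O`, then `g (x + s • e) = g x` for all
`x ∈ O`, `s ∈ ℝ` (the line map `s ↦ g (x + s • e)` has derivative `0`, `is_const_of_deriv_eq_zero`).
[folklore] -/
theorem translate_eq_self_of_fderiv_apply_eq_zero {E : Type*} [NormedAddCommGroup E]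
    [NormedSpace ℝ E] {W : Type*} [NormedAddCommGroup W] [NormedSpace ℝ W] {O : Set E} {e : E}
    (hO : ∀ x ∈ O, ∀ s : ℝ, x + s • e ∈ O) {g : E → W}
    (hg : ∀ y ∈ O, DifferentiableAt ℝ g y) (hz : ∀ y ∈ O, fderiv ℝ g y e = 0) :
    ∀ x ∈ O, ∀ s : ℝ, g (x + s • e) = g x := by
  intro x hx s
  -- the line map and its derivative
  have hline : ∀ σ : ℝ, HasDerivAt (fun σ : ℝ ↦ g (x + σ • e)) (fderiv ℝ g (x + σ • e) e) σ := by
    intro σ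
    have h1 : HasDerivAt (fun σ : ℝ ↦ x + σ • e) e σ := by
      simpa using ((hasDerivAt_id σ).smul_const e).const_add x
    exact ((hg _ (hO x hx σ)).hasFDerivAt.comp_hasDerivAt σ h1)
  have hdiff : Differentiable ℝ fun σ : ℝ ↦ g (x + σ • e) := fun σ ↦ (hline σ).differentiableAt
  have hder : ∀ σ : ℝ, deriv (fun σ : ℝ ↦ g (x + σ • e)) σ = 0 := fun σ ↦ by
    rw [(hline σ).deriv]
    exact hz _ (hO x hx σ)
  have h := is_const_of_deriv_eq_zero hdiff hder s 0
  simpa using h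

/-- **Stationarity of ω-limits from a definite flux family.** Same setting; let `Φ j`, attached to
the members `Kx j` of a family of subsets covering `O`, be functionals which are DEFINITE for the
derivative in the direction `e` on the field `g` (`Φ j g = 0 → fderiv ℝ g y e = 0` on
`Kx j ∩ O`; e.g. a sup or an integral over `Kx j` of `‖∂ₑ ·‖²`), let `g` be differentiable on `O`,
and let every `Φ j` vanish on all translates `g (· + s • e)` (the conclusion of
`flux_omegaLimit_translate_eq_zero_of_transfer` for each `Φ j` when `g` is an ω-limit). Then
`g (x + s • e) = g x` on `O`: the ω-limit is invariant under the background's Killing translation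
("dark limits are stationary in era gauge" — with the physics isolated in the transfer inequality
for a `∂ₑ`-definite local flux). Hale 1980, Ch. X, §1 (ω-limits lie in the largest invariant subset
of `{V̇ = 0}`). [cite: Hale1980, Ch. X §1] -/
theorem omegaLimit_translate_eq_self_of_definite_flux {E : Type*} [NormedAddCommGroup E]
    [NormedSpace ℝ E] {W : Type*} [NormedAddCommGroup W] [NormedSpace ℝ W] {O : Set E} {e : E}
    (hO : ∀ x ∈ O, ∀ s : ℝ, x + s • e ∈ O) (Kx : ℕ → Set E) (hcov : O ⊆ ⋃ j, Kx j)
    (Φ : ℕ → (E → W) → ℝ) {g : E → W} (hg : ∀ y ∈ O, DifferentiableAt ℝ g y)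
    (hdef : ∀ j, Φ j g = 0 → ∀ y ∈ Kx j, y ∈ O → fderiv ℝ g y e = 0)
    (hzero : ∀ j (s : ℝ), Φ j (fun x ↦ g (x + s • e)) = 0) :
    ∀ x ∈ O, ∀ s : ℝ, g (x + s • e) = g x := by
  refine translate_eq_self_of_fderiv_apply_eq_zero hO hg fun y hy ↦ ?_
  obtain ⟨j, hj⟩ := mem_iUnion.1 (hcov hy)
  have h0 : Φ j (fun x ↦ g (x + (0 : ℝ) • e)) = 0 := hzero j 0
  simp only [zero_smul, add_zero] at h0
  exact hdef j h0 y hj hy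

end Summit.FinalStateConjecture.FinalStateConjecture.Theorems.ClusterCompleteness

end
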